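import Summits.BirchSwinnertonDyer.BirchSwinnertonDyer.Theorems.AlignedTransportAtTwoMainConjectureOfRankZeroBSDAtTwoHalfDescentBaseIndexEuler
import Summits.BirchSwinnertonDyer.BirchSwinnertonDyer.Theorems.AlignedTransportAtTwoMainConjectureOfRankZeroBSDAtTwoHalfDescentBaseIndexRankZero
import HarnessLib

/-!
# Route `AlignedTransportAtTwo`, crux C2 `MainConjectureOfRankZeroBSDAtTwo` (stmt-BirchSwinnertonDyer-22298):
# THE BASE TERM CARRIES `p^μ`, XII — WHERE THE `γ`-FREE DOOR CAN OPEN: for EVERY finitely generated torsion `Λ`-module `X` in a rank-`0` tower whose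
# characteristic series is NOT a unit, `p^{ord_p f_X(0) + n} ∣ #(X/ω_nX)` for every `n` — every layer factor `#(X/Ψ_mX)` carries at least one `p`; so gen 60's door
# `0 < #Sel_{p^∞}(E/K_∞)^{Γ_n} < p^{pⁿ} ⟹ μ = 0` REQUIRES `ord_p f_X(0) + n < pⁿ`; on the seed cell of C2 (`p = 2`, `ord₂ f_X(0) = 𝔢 = v + 2e + s ≥ 2`) the door is
# SHUT AT LAYERS `0, 1, 2` FOR EVERY SEED and at layer `n ≥ 3` requires `𝔢 + n < 2ⁿ` (`𝔢 ≤ 4` at `n = 3`)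

HONEST FRAMING (cell `bsd-f1-sign2`, WIDTH-5 attached prover seat `bsd-line-att-p5` gen 61 on line `birth` of the lead `bsd-line-att-p2`;
`--supports` stmt-BirchSwinnertonDyer-22298, closes nothing; BSD is NOT proved by any of this; the crux C2, its verdict «blocked-on
`Rank1Residual.GreenbergMuConjectureIrreducible`» and every registered stub (P / T / Kμ / LimDoor / MuIneqʳ / PFμ⁺) are untouched). THEOREMS ONLY — no `def`,
no instance, no named fact, no `sorry`. An honest NEGATIVE about the lineage's own certificate (numbers, not adjectives): gen 60 proved that over `ℚ` the `γ`-free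
door is COMPLETE (`μ = 0 ⟺` it opens at SOME layer); this file says at WHICH layers it cannot open, from the base term of `…BaseIndexEuler` and the positivity of
every layer index `#(X/Ψ_mX)` when `f_X ∈ 𝔪_Λ`. Ingredients (all tree): g54's tower product `#(X'/ω_nX') = #(X'/TX')·∏_{m<n} #(X'/Ψ_mX')` for `X' = X/F` free of
finite submodules (`…LayerIndexTower.natCard_quotient_omega_eq_mul_prod`), Fulton's `#(X'/Ψ_mX') = #Λ/(f,Ψ_m)` (`…LayerIndexCertificate`), g60's `#(X'/TX') = p^{ord_p f(0)}`
(`…BaseIndex`), `#Λ/(f, Ψ_m) = p^{v_m}` (`…LayerIndexTower.exists_natCard_quotient_span_sup_span_coe_eq_pow`), and `Λ` local with `Ψ_m, f ∈ 𝔪_Λ`.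

* §1 ★ `p_dvd_natCard_quotient_span_sup_span_coe`: `g` Eisenstein-prime (`g(0) = p`), `g ∤ f`, `f(0) ∉ ℤ_pˣ` ⟹ **`p ∣ #Λ/(f, g)`**; ★ `natCard_quotient_quotient_smul_top_dvd`:
  **`#((X/F)/a(X/F)) ∣ #(X/aX)`** for every submodule `F` and `a ∈ Λ`.
* §2 ★★★ `pow_valuation_add_dvd_natCard_quotient_omega`: `X` f.g. torsion (finite submodules allowed), `char_Λ X = (f)`, `f(0) ≠ 0` not a unit, `Ψ_m ∤ f` (`m < n`) ⟹
  **`p^{ord_p f(0) + n} ∣ #(X/ω_nX)`**; ★★★ `pow_valuation_add_dvd_natCard_quotient_omega_of_forall_pos` (rank-`0` tower: all `#(X/ω_nX) > 0`) and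
  ★★ `valuation_add_lt_of_natCard_quotient_omega_lt`: **`#(X/ω_nX) < p^{pⁿ} ⟹ ord_p f(0) + n < pⁿ`**.
* §3 (Selmer currency, ANY `K`, `p`, `ℤ_p`-extension, dual datum with `X` f.g. torsion, rank-`0` tower) ★★★ `pow_valuation_add_dvd_natCard_selmerInvariants`:
  **`p^{ord_p f_X(0) + n} ∣ #Sel_{p^∞}(E/K_∞)^{Γ_n}`**, ★★ `valuation_add_lt_of_door`: the `γ`-free door at layer `n` forces **`ord_p f_X(0) + n < pⁿ`**; honest form with Lemma 4.3
  ★★ `pow_valuation_add_dvd_natCard_selmerLayer_mul_kerG`: **`p^{ord_p f_X(0) + n} ∣ #Sel_{p^∞}(E/K_n)·#ker g_n`**.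
* §4 (`ℚ`, good ORDINARY `p`, cell `W(ℚ)[p] = 0`; `ord_p f_X(0) = v + 2e + s` by `…BaseIndexEuler`) ★★★ `pow_eulerWeight_add_dvd_natCard_selmerLayer_mul_kerG_rat`:
  **`p^{v + 2e + s + n} ∣ #Sel_{p^∞}(W/ℚ_n)·#ker g_n`** at every layer of a rank-`0` tower, and the door at layer `n` forces **`v + 2e + s + n < pⁿ`** (when `v + 2e + s ≥ 1`).
* §5 (`p = 2`, the SEED CELL of C2: good ordinary at `2`, no rational `2`-torsion abscissa, `𝔢 = v + 2·ord₂ #W̃(𝔽₂) + s ≥ 2`) ★★★ `two_pow_add_dvd_natCard_selmerLayer_mul_kerG_seed`: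
  **`2^{𝔢 + n} ∣ #Sel_{2^∞}(W/ℚ_n)·#ker g_n`** for every `n`, and at any layer the door forces **`𝔢 + n < 2ⁿ`**; ★★★ `not_door_of_le_two`: **the `γ`-free door
  `#Sel_{2^∞}(W/ℚ_n)·#ker g_n < 2^{2ⁿ}` is FALSE at `n = 0, 1, 2` for EVERY seed**; ★★ `eulerWeight_le_of_door_three_four`: `n = 3` needs `𝔢 ≤ 4`, `n = 4` needs `𝔢 ≤ 11`.
Reading for C2 / the next LEAD / -data: the honest NUMBER ask of the `γ`-free door starts at the degree-`8` layer `ℚ_3 = ℚ(ζ_32)⁺`, and only for seeds with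
`v₂(Tam) + 2·ord₂ #W̃(𝔽₂) + v₂(#Ш[2^∞]) ≤ 4`; the relative doors of gens 55–58 (`#(X/Ψ_nX) < 2^{2ⁿ}`, norm kernels, twists) are not affected by this bound.
Nothing numerical is asserted about any curve; C2 untouched. Memo `Cruxes/MainConjectureOfRankZeroBSDAtTwo/EULER-BRIDGE-att-p5-g61.md`.

References: R. Greenberg, LNM 1716 (1999), Conj. 1.11, §4 Thm. 4.1, Lemmas 4.2–4.3 [GreenbergLNM1716]; L. Washington, GTM 83, §7.1, §13.2, §13.3 (Lemma 13.18, Thm. 13.13)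
[Washington1997]; W. Fulton, *Intersection Theory*, Lemma A.2.6 [Fulton1998].
-/

set_option linter.dupNamespace false
set_option autoImplicit false

noncomputable section

open scoped Classical Polynomial

universe u

namespace Summit.BirchSwinnertonDyer.BirchSwinnertonDyer.Theorems.AlignedTransportAtTwoHalfDescentBaseIndexDoorLayers

open WeierstrassCurve Literature.NumberTheory.EllipticCurves Literature.NumberTheory.EllipticCurves.IwasawaAlgebra
  Literature.NumberTheory.EllipticCurves.Rank1Residual
  Summit.BirchSwinnertonDyer.Rank1Residual.X1.MuLambda
  Summit.BirchSwinnertonDyer.Rank1Residual.X1.GeneratorBoundMu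
  Summit.BirchSwinnertonDyer.Rank1Residual.Iwasawa
  Summit.BirchSwinnertonDyer.BirchSwinnertonDyer.Theorems.DefectPrime
  Summit.BirchSwinnertonDyer.BirchSwinnertonDyer.Theorems.AlignedTransportAtTwoCyclotomicLayerPrime
  Summit.BirchSwinnertonDyer.BirchSwinnertonDyer.Theorems.AlignedTransportAtTwoHalfDescentLayerIndex
  Summit.BirchSwinnertonDyer.BirchSwinnertonDyer.Theorems.AlignedTransportAtTwoHalfDescentLayerIndexTower
  Summit.BirchSwinnertonDyer.BirchSwinnertonDyer.Theorems.AlignedTransportAtTwoHalfDescentLayerIndexFinite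
  Summit.BirchSwinnertonDyer.BirchSwinnertonDyer.Theorems.AlignedTransportAtTwoHalfDescentLayerIndexCertificate
  Summit.BirchSwinnertonDyer.BirchSwinnertonDyer.Theorems.AlignedTransportAtTwoHalfDescentLayerIndexGrowth
  Summit.BirchSwinnertonDyer.BirchSwinnertonDyer.Theorems.AlignedTransportAtTwoHalfDescentLayerIndexSelmer
  Summit.BirchSwinnertonDyer.BirchSwinnertonDyer.Theorems.AlignedTransportAtTwoHalfDescentLayerIndexGrowthFiniteCell
  Summit.BirchSwinnertonDyer.BirchSwinnertonDyer.Theorems.AlignedTransportAtTwoHalfDescentBaseIndex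
  Summit.BirchSwinnertonDyer.BirchSwinnertonDyer.Theorems.AlignedTransportAtTwoHalfDescentBaseIndexSelmer
  Summit.BirchSwinnertonDyer.BirchSwinnertonDyer.Theorems.AlignedTransportAtTwoHalfDescentBaseIndexRankZero
  Summit.BirchSwinnertonDyer.BirchSwinnertonDyer.Theorems.AlignedTransportAtTwoHalfDescentBaseIndexEuler

/-! ## §1 Algebra: `p ∣ #Λ/(f, g)` when `f, g ∈ 𝔪_Λ`; `#((X/F)/a) ∣ #(X/a)` -/

section Algebra

variable {p : ℕ} [hp : Fact p.Prime]

/-- ★ **`p ∣ #Λ/(f, g)`** for an Eisenstein-prime `g` (`g(0) = p`, `g` prime in `Λ`) not dividing `f`, as soon as `f(0)` is NOT a unit of `ℤ_p`: both generators lie in the maximal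
ideal `𝔪_Λ = (p, T)` of the local ring `Λ`, so the (finite, tree: `= p^v`) quotient is a nontrivial ring. [cite: Washington1997, §7.1 and §13.2] -/
theorem p_dvd_natCard_quotient_span_sup_span_coe {g : ℤ_[p][X]} (hg0 : PowerSeries.constantCoeff (g : IwasawaAlgebra p) = p) (hgp : Prime (g : IwasawaAlgebra p))
    {f : IwasawaAlgebra p} (hgf : ¬ (g : IwasawaAlgebra p) ∣ f) (hf : ¬ IsUnit (PowerSeries.constantCoeff f)) :
    p ∣ Nat.card (IwasawaAlgebra p ⧸ (Ideal.span {f} ⊔ Ideal.span {(g : IwasawaAlgebra p)})) := by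
  obtain ⟨v, hv⟩ := exists_natCard_quotient_span_sup_span_coe_eq_pow hg0 hgp hgf
  -- both generators lie in the maximal ideal of the local ring `Λ`
  have hfm : f ∈ IsLocalRing.maximalIdeal (IwasawaAlgebra p) := by
    rw [IsLocalRing.mem_maximalIdeal, mem_nonunits_iff, PowerSeries.isUnit_iff_constantCoeff]
    exact hf
  have hgm : (g : IwasawaAlgebra p) ∈ IsLocalRing.maximalIdeal (IwasawaAlgebra p) := by
    rw [IsLocalRing.mem_maximalIdeal, mem_nonunits_iff, PowerSeries.isUnit_iff_constantCoeff, hg0]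
    exact PadicInt.p_nonunit
  have hle : Ideal.span {f} ⊔ Ideal.span {(g : IwasawaAlgebra p)} ≤ IsLocalRing.maximalIdeal (IwasawaAlgebra p) :=
    sup_le ((Ideal.span_singleton_le_iff_mem _).mpr hfm) ((Ideal.span_singleton_le_iff_mem _).mpr hgm)
  have hne : Ideal.span {f} ⊔ Ideal.span {(g : IwasawaAlgebra p)} ≠ ⊤ :=
    ne_top_of_le_ne_top (IsLocalRing.maximalIdeal.isMaximal _).ne_top hle
  haveI : Nontrivial (IwasawaAlgebra p ⧸ (Ideal.span {f} ⊔ Ideal.span {(g : IwasawaAlgebra p)})) := Ideal.Quotient.nontrivial_iff.mpr hne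
  haveI : Finite (IwasawaAlgebra p ⧸ (Ideal.span {f} ⊔ Ideal.span {(g : IwasawaAlgebra p)})) :=
    Nat.finite_of_card_ne_zero (by rw [hv]; exact pow_ne_zero _ hp.out.ne_zero)
  have h1 : 1 < Nat.card (IwasawaAlgebra p ⧸ (Ideal.span {f} ⊔ Ideal.span {(g : IwasawaAlgebra p)})) := Finite.one_lt_card
  rw [hv] at h1 ⊢
  have hv0 : v ≠ 0 := by rintro rfl; simp at h1
  exact dvd_pow_self p hv0

variable {M : Type u} [AddCommGroup M] [Module (IwasawaAlgebra p) M]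

/-- ★ **`#((X/F)/a·(X/F)) ∣ #(X/aX)`** for every submodule `F ≤ X` and every `a ∈ Λ` (`Nat.card`; the natural surjection `X/aX ↠ (X/F)/a(X/F)`). [folklore] -/
theorem natCard_quotient_quotient_smul_top_dvd (F : Submodule (IwasawaAlgebra p) M) (a : IwasawaAlgebra p) :
    Nat.card ((M ⧸ F) ⧸ (Ideal.span {a} • ⊤ : Submodule (IwasawaAlgebra p) (M ⧸ F))) ∣ Nat.card (M ⧸ (Ideal.span {a} • ⊤ : Submodule (IwasawaAlgebra p) M)) := by
  have hle : (Ideal.span {a} • ⊤ : Submodule (IwasawaAlgebra p) M) ≤ (Ideal.span {a} • ⊤ : Submodule (IwasawaAlgebra p) (M ⧸ F)).comap F.mkQ := by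
    rw [← Submodule.map_le_iff_le_comap, Submodule.map_smul'', Submodule.map_top, Submodule.range_mkQ]
  let φ := (Ideal.span {a} • ⊤ : Submodule (IwasawaAlgebra p) M).mapQ (Ideal.span {a} • ⊤ : Submodule (IwasawaAlgebra p) (M ⧸ F)) F.mkQ hle
  have hφ : Function.Surjective φ := by
    intro y
    obtain ⟨z, rfl⟩ := Submodule.mkQ_surjective _ y
    obtain ⟨x, rfl⟩ := Submodule.mkQ_surjective _ z
    exact ⟨Submodule.mkQ _ x, rfl⟩
  exact AddSubgroup.card_dvd_of_surjective φ.toAddMonoidHom hφ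

end Algebra

/-! ## §2 `p^{ord_p f(0) + n} ∣ #(X/ω_nX)` for every f.g. torsion `X` with non-unit characteristic series in a rank-`0` tower -/

section Module

variable {p : ℕ} [hp : Fact p.Prime] {M : Type u} [AddCommGroup M] [Module (IwasawaAlgebra p) M]

/-- ★★★ **`p^{ord_p f(0) + n} ∣ #(X/ω_nX)`** — `X` ANY finitely generated torsion `Λ`-module (finite submodules allowed), `char_Λ X = (f)` with `f(0) ≠ 0` NOT a unit of `ℤ_p`
(i.e. `f ∉ Λˣ`: `μ ≥ 1` or `λ ≥ 1`), `Ψ_m ∤ f` for `m < n`. With `X' = X/F` (`F` the largest finite submodule): `#(X'/ω_nX') = p^{ord_p f(0)}·∏_{m<n} #Λ/(f,Ψ_m)` and each factor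
is a positive power of `p`; `#(X'/ω_nX') ∣ #(X/ω_nX)`. [cite: Washington1997, §13.3 (Lemma 13.18, Thm. 13.13)] [cite: GreenbergLNM1716, §4 Lemma 4.2] [cite: Fulton1998, Lemma A.2.6] -/
theorem pow_valuation_add_dvd_natCard_quotient_omega [Module.Finite (IwasawaAlgebra p) M] (hM : Module.IsTorsion (IwasawaAlgebra p) M) {f : IwasawaAlgebra p}
    (hchar : Literature.NumberTheory.EllipticCurves.Module.charIdeal (IwasawaAlgebra p) M = Ideal.span {f}) (h0 : PowerSeries.constantCoeff f ≠ 0)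
    (hf : ¬ IsUnit (PowerSeries.constantCoeff f)) {n : ℕ}
    (hΨ : ∀ m < n, ¬ ((((Polynomial.cyclotomic (p ^ (m + 1)) ℤ_[p]).comp (Polynomial.X + 1) : ℤ_[p][X]) : IwasawaAlgebra p) ∣ f)) :
    p ^ ((PowerSeries.constantCoeff f).valuation + n) ∣
      Nat.card (M ⧸ (Ideal.span {((1 + PowerSeries.X : PowerSeries ℤ_[p]) ^ (p ^ n) - 1 : IwasawaAlgebra p)} • ⊤ : Submodule (IwasawaAlgebra p) M)) := by
  -- pass to `X' = X/F`, free of finite submodules, with the same characteristic ideal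
  haveI : IsNoetherian (IwasawaAlgebra p) M := inferInstance
  obtain ⟨F, hFfin, hFmax⟩ := exists_finite_submodule_forall_finite_le (R := IwasawaAlgebra p) (M := M)
  haveI : Finite F := hFfin
  have hF := forall_finite_eq_bot_quotient_of_forall_finite_le F hFmax
  obtain ⟨hM', hchar'⟩ := isTorsion_and_charIdeal_quotient_eq hM F
  rw [hchar] at hchar'
  refine Dvd.dvd.trans ?_ (natCard_quotient_quotient_smul_top_dvd F _)
  rw [natCard_quotient_omega_eq_mul_prod hM' hF hchar' h0 hΨ, natCard_quotient_X_smul_top_eq_pow hM' hF hchar' h0, pow_add]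
  refine mul_dvd_mul_left _ ?_
  -- each layer factor `#(X'/Ψ_mX') = #Λ/(f, Ψ_m)` is a multiple of `p`
  have hfac : ∀ m ∈ Finset.range n, p ∣ Nat.card ((M ⧸ F) ⧸ (Ideal.span {(((Polynomial.cyclotomic (p ^ (m + 1)) ℤ_[p]).comp (Polynomial.X + 1) : ℤ_[p][X]) :
      IwasawaAlgebra p)} • ⊤ : Submodule (IwasawaAlgebra p) (M ⧸ F))) := fun m hm ↦ by
    have hmn : m < n := Finset.mem_range.mp hm
    rw [natCard_quotient_smul_top_eq_natCard_quotient_span_sup (constantCoeff_cyclotomicLayer p m) (prime_coe_cyclotomic_comp p m) hM' hF hchar' (hΨ m hmn)]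
    exact p_dvd_natCard_quotient_span_sup_span_coe (constantCoeff_cyclotomicLayer p m) (prime_coe_cyclotomic_comp p m) (hΨ m hmn) hf
  calc p ^ n = ∏ _m ∈ Finset.range n, p := by rw [Finset.prod_const, Finset.card_range]
    _ ∣ _ := Finset.prod_dvd_prod_of_dvd _ _ hfac

/-- ★★★ **RANK-`0` TOWER FORM: if every `#(X/ω_nX)` is positive and `f(0) ∉ ℤ_pˣ` then `p^{ord_p f(0) + n} ∣ #(X/ω_nX)` for EVERY `n`** (`X` any f.g. torsion `Λ`-module with `char_Λ X = (f)`).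
[cite: Washington1997, §13.3 (Thm. 13.13)] [cite: GreenbergLNM1716, Conj. 1.11, §4 Lemma 4.2] -/
theorem pow_valuation_add_dvd_natCard_quotient_omega_of_forall_pos [Module.Finite (IwasawaAlgebra p) M] (hM : Module.IsTorsion (IwasawaAlgebra p) M)
    {f : IwasawaAlgebra p} (hchar : Literature.NumberTheory.EllipticCurves.Module.charIdeal (IwasawaAlgebra p) M = Ideal.span {f})
    (hf : ¬ IsUnit (PowerSeries.constantCoeff f))
    (hpos : ∀ n, 0 < Nat.card (M ⧸ (Ideal.span {((1 + PowerSeries.X : PowerSeries ℤ_[p]) ^ (p ^ n) - 1 : IwasawaAlgebra p)} • ⊤ : Submodule (IwasawaAlgebra p) M))) (n : ℕ) :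
    p ^ ((PowerSeries.constantCoeff f).valuation + n) ∣
      Nat.card (M ⧸ (Ideal.span {((1 + PowerSeries.X : PowerSeries ℤ_[p]) ^ (p ^ n) - 1 : IwasawaAlgebra p)} • ⊤ : Submodule (IwasawaAlgebra p) M)) := by
  obtain ⟨h0, hΨ⟩ := (forall_natCard_quotient_omega_pos_iff hM hchar).mp hpos
  exact pow_valuation_add_dvd_natCard_quotient_omega hM hchar h0 hf fun m _ ↦ hΨ m

/-- ★★ **The `γ`-free door needs room: `0 < #(X/ω_nX) < p^{pⁿ}` at layer `n` (and `f(0) ∉ ℤ_pˣ`, rank-`0` tower) forces `ord_p f(0) + n < pⁿ`.**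
[cite: Washington1997, §13.3 (Thm. 13.13)] [cite: GreenbergLNM1716, Conj. 1.11] -/
theorem valuation_add_lt_of_natCard_quotient_omega_lt [Module.Finite (IwasawaAlgebra p) M] (hM : Module.IsTorsion (IwasawaAlgebra p) M)
    {f : IwasawaAlgebra p} (hchar : Literature.NumberTheory.EllipticCurves.Module.charIdeal (IwasawaAlgebra p) M = Ideal.span {f})
    (hf : ¬ IsUnit (PowerSeries.constantCoeff f))
    (hpos : ∀ n, 0 < Nat.card (M ⧸ (Ideal.span {((1 + PowerSeries.X : PowerSeries ℤ_[p]) ^ (p ^ n) - 1 : IwasawaAlgebra p)} • ⊤ : Submodule (IwasawaAlgebra p) M))) {n : ℕ}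
    (hlt : Nat.card (M ⧸ (Ideal.span {((1 + PowerSeries.X : PowerSeries ℤ_[p]) ^ (p ^ n) - 1 : IwasawaAlgebra p)} • ⊤ : Submodule (IwasawaAlgebra p) M)) < p ^ (p ^ n)) :
    (PowerSeries.constantCoeff f).valuation + n < p ^ n := by
  have hdvd := pow_valuation_add_dvd_natCard_quotient_omega_of_forall_pos hM hchar hf hpos n
  have hle := Nat.le_of_dvd (hpos n) hdvd
  exact (Nat.pow_lt_pow_iff_right hp.out.one_lt).mp (lt_of_le_of_lt hle hlt)

end Module

/-! ## §3 Selmer currency: `p^{ord_p f_X(0) + n} ∣ #Sel_{p^∞}(E/K_∞)^{Γ_n}` and `∣ #Sel_{p^∞}(E/K_n)·#ker g_n` -/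

section Selmer

variable {K : Type u} [Field K] [NumberField K] (W : WeierstrassCurve K) {p : ℕ} [hp : Fact p.Prime] (κ : ZpExtension K p)
  {γ : Field.absoluteGaloisGroup K}

/-- ★★★ **`p^{ord_p f_X(0) + n} ∣ #Sel_{p^∞}(E/K_∞)^{Γ_n}` at EVERY layer of a rank-`0` tower** — `E/K`, ANY `p`, ANY `ℤ_p`-extension with topological generator `γ`, any dual datum with `X`
f.g. torsion, `char_Λ X = (f_X)` with `f_X(0) ∉ ℤ_pˣ`, every `Sel_{p^∞}(E/K_∞)^{Γ_n}` finite. [cite: GreenbergLNM1716, Conj. 1.11, §4 Lemma 4.2] [cite: Washington1997, §13.3 Thm. 13.13] -/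
theorem pow_valuation_add_dvd_natCard_selmerInvariants (hγ : κ.IsTopGenerator γ) (D : W.SelmerDualData κ γ) [Module.Finite (IwasawaAlgebra p) D.X] (hD : D.IsTorsion)
    {f : IwasawaAlgebra p} (hchar : D.charIdeal = Ideal.span {f}) (hf : ¬ IsUnit (PowerSeries.constantCoeff f))
    (hpos : ∀ n, 0 < Nat.card ↥(W.selmerInfty κ ⊓ W.layerInvariants κ n)) (n : ℕ) :
    p ^ ((PowerSeries.constantCoeff f).valuation + n) ∣ Nat.card ↥(W.selmerInfty κ ⊓ W.layerInvariants κ n) := by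
  have hpos' : ∀ n, 0 < Nat.card (D.X ⧸ (Ideal.span {((1 + PowerSeries.X : PowerSeries ℤ_[p]) ^ (p ^ n) - 1 : IwasawaAlgebra p)} • ⊤ : Submodule (IwasawaAlgebra p) D.X)) :=
    fun n ↦ by rw [natCard_layerQuotient_omega_eq_natCard_selmerInvariants W κ hγ D n]; exact hpos n
  rw [← natCard_layerQuotient_omega_eq_natCard_selmerInvariants W κ hγ D n]
  exact pow_valuation_add_dvd_natCard_quotient_omega_of_forall_pos (M := D.X) hD hchar hf hpos' n

/-- ★★ **The `γ`-free door at layer `n` (`#Sel_{p^∞}(E/K_∞)^{Γ_n} < p^{pⁿ}`, gen 60 `…BaseIndexSelmer.mu_eq_zero_of_natCard_selmerInvariants_pos_lt`) forces `ord_p f_X(0) + n < pⁿ`**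
(rank-`0` tower, `f_X(0) ∉ ℤ_pˣ`). [cite: GreenbergLNM1716, Conj. 1.11] [cite: Washington1997, §13.3 Thm. 13.13] -/
theorem valuation_add_lt_of_door (hγ : κ.IsTopGenerator γ) (D : W.SelmerDualData κ γ) [Module.Finite (IwasawaAlgebra p) D.X] (hD : D.IsTorsion)
    {f : IwasawaAlgebra p} (hchar : D.charIdeal = Ideal.span {f}) (hf : ¬ IsUnit (PowerSeries.constantCoeff f))
    (hpos : ∀ n, 0 < Nat.card ↥(W.selmerInfty κ ⊓ W.layerInvariants κ n)) {n : ℕ} (hlt : Nat.card ↥(W.selmerInfty κ ⊓ W.layerInvariants κ n) < p ^ (p ^ n)) :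
    (PowerSeries.constantCoeff f).valuation + n < p ^ n := by
  have hle := Nat.le_of_dvd (hpos n) (pow_valuation_add_dvd_natCard_selmerInvariants W κ hγ D hD hchar hf hpos n)
  exact (Nat.pow_lt_pow_iff_right hp.out.one_lt).mp (lt_of_le_of_lt hle hlt)

/-- ★★ **Honest form (Lemma 4.3): `p^{ord_p f_X(0) + n} ∣ #Sel_{p^∞}(E/K_n)·#ker g_n`** at every layer where these are positive — rank-`0` tower in honest terms
(`∀ n, 0 < #Sel_{p^∞}(E/K_n)·#ker g_n`), `f_X(0) ∉ ℤ_pˣ`; the restriction kernel drops out as in gen 60's file III. [cite: GreenbergLNM1716, §4 Lemma 4.3, Conj. 1.11] -/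
theorem pow_valuation_add_dvd_natCard_selmerLayer_mul_kerG (hγ : κ.IsTopGenerator γ) (D : W.SelmerDualData κ γ) [Module.Finite (IwasawaAlgebra p) D.X] (hD : D.IsTorsion)
    {f : IwasawaAlgebra p} (hchar : D.charIdeal = Ideal.span {f}) (hf : ¬ IsUnit (PowerSeries.constantCoeff f))
    (hpos : ∀ n, 0 < Nat.card ↥(W.selmerLayer κ n) * Nat.card (W.KerG κ n)) (n : ℕ) :
    p ^ ((PowerSeries.constantCoeff f).valuation + n) ∣ Nat.card ↥(W.selmerLayer κ n) * Nat.card (W.KerG κ n) := by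
  have h43 : ∀ n, Nat.card ↥(W.selmerInfty κ ⊓ W.layerInvariants κ n) * Nat.card (W.layerToInfty κ n).ker = Nat.card ↥(W.selmerLayer κ n) * Nat.card (W.KerG κ n) :=
    fun n ↦ W.natCard_selmerInvariants_mul_natCard_ker_layerToInfty κ n
  have hS : ∀ n, 0 < Nat.card ↥(W.selmerInfty κ ⊓ W.layerInvariants κ n) := fun n ↦ by
    have h := hpos n
    rw [← h43 n] at h
    exact Nat.pos_of_mul_pos_right h
  rw [← h43 n]
  exact (pow_valuation_add_dvd_natCard_selmerInvariants W κ hγ D hD hchar hf hS n).mul_right _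

end Selmer

/-! ## §4 `K = ℚ`, good ordinary `p`, the cell `W(ℚ)[p] = 0`: `p^{v + 2e + s + n} ∣ #Sel_{p^∞}(W/ℚ_n)·#ker g_n` -/

section Rat

variable (W : WeierstrassCurve ℚ) [W.IsElliptic] [W.IsGloballyMinimal] {p : ℕ} [hp : Fact p.Prime] (κ : ZpExtension ℚ p) {γ : Field.absoluteGaloisGroup ℚ}

/-- `1 ≤ ord_p c ⟹ c ∉ ℤ_pˣ`. [folklore] -/
private theorem not_isUnit_of_one_le_valuation {c : ℤ_[p]} (h : 1 ≤ c.valuation) : ¬ IsUnit c := by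
  intro hu
  have hu1 : ‖c‖ = 1 := PadicInt.isUnit_iff.mp hu
  have hne : c ≠ 0 := hu.ne_zero
  have hn := PadicInt.norm_eq_zpow_neg_valuation hne
  rw [hu1, eq_comm, zpow_eq_one_iff_right₀ (by exact_mod_cast hp.out.pos.le) (by exact_mod_cast hp.out.one_lt.ne')] at hn
  omega

/-- ★★★ **OVER `ℚ` ON THE CELL: `p^{v + 2e + s + n} ∣ #Sel_{p^∞}(W/ℚ_n)·#ker g_n` at EVERY layer of a rank-`0` tower** — `W/ℚ` globally minimal, good ORDINARY at `p` (ANY `p`), `W(ℚ)[p] = 0`,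
`κ` cyclotomic with generator `γ`, any dual datum, `Sel_{p^∞}(W/ℚ)` finite, all `#Sel_{p^∞}(W/ℚ_n)·#ker g_n > 0`, and `v + 2e + s ≥ 1` (`v = ord_p Tam(W)`, `e = ord_p #W̃(𝔽_p)[p^∞]`,
`s = ord_p #Sel_{p^∞}(W/ℚ)`); and the `γ`-free door at layer `n` forces **`v + 2e + s + n < pⁿ`**. (`ord_p f_X(0) = v + 2e + s` by `…BaseIndexEuler`.)
[cite: GreenbergLNM1716, §4 Thm. 4.1, Lemmas 4.2–4.3, Conj. 1.11] [cite: Washington1997, §13.3 Thm. 13.13] -/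
theorem pow_eulerWeight_add_dvd_natCard_selmerLayer_mul_kerG_rat (hgo : GoodOrd W p) (hκ : κ.IsCyclotomic) (hγ : κ.IsTopGenerator γ)
    (hK : ∀ P : W.toAffine.Point, p • P = 0 → P = 0) (D : W.SelmerDualData κ γ) [hSel : Finite (W.selmerGroupPInfty p)]
    (hpos : ∀ n, 0 < Nat.card ↥(W.selmerLayer κ n) * Nat.card (W.KerG κ n))
    (h1 : 1 ≤ padicValNat p W.tamagawaProduct + 2 * padicValNat p (Nat.card (AddCommGroup.primaryComponent ((integralModelInt W).map (Int.castRingHom (ZMod p))).toAffine.Point p)) +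
      padicValNat p (Nat.card (W.selmerGroupPInfty p))) (n : ℕ) :
    p ^ (padicValNat p W.tamagawaProduct + 2 * padicValNat p (Nat.card (AddCommGroup.primaryComponent ((integralModelInt W).map (Int.castRingHom (ZMod p))).toAffine.Point p)) +
        padicValNat p (Nat.card (W.selmerGroupPInfty p)) + n) ∣ Nat.card ↥(W.selmerLayer κ n) * Nat.card (W.KerG κ n) ∧
      (Nat.card ↥(W.selmerLayer κ n) * Nat.card (W.KerG κ n) < p ^ (p ^ n) →
        padicValNat p W.tamagawaProduct + 2 * padicValNat p (Nat.card (AddCommGroup.primaryComponent ((integralModelInt W).map (Int.castRingHom (ZMod p))).toAffine.Point p)) +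
          padicValNat p (Nat.card (W.selmerGroupPInfty p)) + n < p ^ n) := by
  haveI : Module.Finite (IwasawaAlgebra p) D.X := D.module_finite_holds hγ
  have hD : D.IsTorsion := D.isTorsion_of_finite_selmerGroup_rat hκ (W.hasGoodReductionAt_and_hasUnitRootAt_of_rat hgo.1 hgo.2) hγ hSel
  obtain ⟨fX, -, hchar⟩ := exists_charGenerator_ne_zero D.X hD
  obtain ⟨-, -, hval⟩ := constantCoeff_ne_zero_and_valuation_add_eq W κ hgo hκ hγ D hchar
  rw [natCard_primaryComponent_eq_one_of_noPTorsion W hK, padicValNat_one_right, mul_zero, add_zero] at hval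
  have hf : ¬ IsUnit (PowerSeries.constantCoeff fX) := not_isUnit_of_one_le_valuation (by omega)
  have hdvd := pow_valuation_add_dvd_natCard_selmerLayer_mul_kerG W κ hγ D hD hchar hf hpos n
  rw [hval] at hdvd
  refine ⟨hdvd, fun hlt ↦ ?_⟩
  have hle := Nat.le_of_dvd (hpos n) hdvd
  exact (Nat.pow_lt_pow_iff_right hp.out.one_lt).mp (lt_of_le_of_lt hle hlt)

end Rat

/-! ## §5 `p = 2`: on the seed cell of C2 the `γ`-free door is shut at layers `0, 1, 2`, and at layer `n` needs `𝔢 + n < 2ⁿ` -/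

section Two

variable (W : WeierstrassCurve ℚ) [W.IsElliptic] [W.IsGloballyMinimal] (κ₂ : ZpExtension ℚ 2) {γ : Field.absoluteGaloisGroup ℚ}

/-- ★★★ **THE SEED: `2^{𝔢 + n} ∣ #Sel_{2^∞}(W/ℚ_n)·#ker g_n` at EVERY layer, `𝔢 = ord₂ Tam(W) + 2·ord₂ #W̃(𝔽₂) + ord₂ #Sel_{2^∞}(W/ℚ) ≥ 2`** — `W/ℚ` globally minimal, good ORDINARY at `2`, no rational
`2`-torsion abscissa (C2's binder), `κ` cyclotomic with generator `γ`, any dual datum, `Sel_{2^∞}(W/ℚ)` finite, every `#Sel_{2^∞}(W/ℚ_n)·#ker g_n > 0` (rank-`0` tower in honest terms);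
and the door `#Sel_{2^∞}(W/ℚ_n)·#ker g_n < 2^{2ⁿ}` at layer `n` forces **`𝔢 + n < 2ⁿ`**. [cite: GreenbergLNM1716, §4 Thm. 4.1, Lemmas 4.2–4.3, Conj. 1.11] [cite: Washington1997, §13.3 Thm. 13.13] -/
theorem two_pow_add_dvd_natCard_selmerLayer_mul_kerG_seed (hgo : GoodOrd W 2) (ht : ∀ x : ℚ, ¬ Greenberg1999.HasRationalTwoTorsionX W x) (hκ : κ₂.IsCyclotomic)
    (hγ : κ₂.IsTopGenerator γ) (D : W.SelmerDualData κ₂ γ) [hSel : Finite (W.selmerGroupPInfty 2)] (hpos : ∀ n, 0 < Nat.card ↥(W.selmerLayer κ₂ n) * Nat.card (W.KerG κ₂ n))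
    (n : ℕ) :
    2 ≤ padicValNat 2 W.tamagawaProduct + 2 * padicValNat 2 (W.reductionPointCount 2) + padicValNat 2 (Nat.card (W.selmerGroupPInfty 2)) ∧
    2 ^ (padicValNat 2 W.tamagawaProduct + 2 * padicValNat 2 (W.reductionPointCount 2) + padicValNat 2 (Nat.card (W.selmerGroupPInfty 2)) + n) ∣
        Nat.card ↥(W.selmerLayer κ₂ n) * Nat.card (W.KerG κ₂ n) ∧
      (Nat.card ↥(W.selmerLayer κ₂ n) * Nat.card (W.KerG κ₂ n) < 2 ^ (2 ^ n) →
        padicValNat 2 W.tamagawaProduct + 2 * padicValNat 2 (W.reductionPointCount 2) + padicValNat 2 (Nat.card (W.selmerGroupPInfty 2)) + n < 2 ^ n) := by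
  have he := one_le_padicValNat_natCard_primaryComponent_reduction_two W hgo
  have hN : Nat.card ((integralModelInt W).map (Int.castRingHom (ZMod 2))).toAffine.Point = W.reductionPointCount 2 := rfl
  have h := pow_eulerWeight_add_dvd_natCard_selmerLayer_mul_kerG_rat W κ₂ hgo hκ hγ (forall_two_nsmul_eq_zero W ht) D hpos (by omega) n
  rw [natCard_primaryComponent_eq_pow_padicValNat 2, padicValNat.prime_pow, hN] at h he
  exact ⟨by omega, h⟩

/-- ★★★ **THE `γ`-FREE DOOR IS SHUT AT LAYERS `0`, `1`, `2` FOR EVERY SEED** (hypotheses of `two_pow_add_dvd_natCard_selmerLayer_mul_kerG_seed`): for `n ≤ 2`,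
**`¬ (#Sel_{2^∞}(W/ℚ_n)·#ker g_n < 2^{2ⁿ})`** — indeed `#Sel_{2^∞}(W/ℚ_n)·#ker g_n ≥ 2^{𝔢+n} ≥ 2^{2+n} ≥ 2^{2ⁿ}` for `n ≤ 2`. The honest number ask of gen 60's door therefore starts at
`ℚ_3 = ℚ(ζ_32)⁺` (degree `8`). [cite: GreenbergLNM1716, Conj. 1.11, §4 Thm. 4.1] -/
theorem not_door_of_le_two (hgo : GoodOrd W 2) (ht : ∀ x : ℚ, ¬ Greenberg1999.HasRationalTwoTorsionX W x) (hκ : κ₂.IsCyclotomic)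
    (hγ : κ₂.IsTopGenerator γ) (D : W.SelmerDualData κ₂ γ) [hSel : Finite (W.selmerGroupPInfty 2)] (hpos : ∀ n, 0 < Nat.card ↥(W.selmerLayer κ₂ n) * Nat.card (W.KerG κ₂ n))
    {n : ℕ} (hn : n ≤ 2) : ¬ Nat.card ↥(W.selmerLayer κ₂ n) * Nat.card (W.KerG κ₂ n) < 2 ^ (2 ^ n) := by
  intro hlt
  obtain ⟨h2, -, hdoor⟩ := two_pow_add_dvd_natCard_selmerLayer_mul_kerG_seed W κ₂ hgo ht hκ hγ D hpos n
  have h := hdoor hlt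
  interval_cases n <;> omega

/-- ★★ **At layer `3` the door needs `𝔢 ≤ 4`, at layer `4` it needs `𝔢 ≤ 11`** (same hypotheses): `#Sel_{2^∞}(W/ℚ_n)·#ker g_n < 2^{2ⁿ}` with `n = 3` forces
`ord₂ Tam(W) + 2·ord₂ #W̃(𝔽₂) + ord₂ #Sel_{2^∞}(W/ℚ) ≤ 4`, and with `n = 4` forces `≤ 11`. [cite: GreenbergLNM1716, Conj. 1.11, §4 Thm. 4.1] -/
theorem eulerWeight_le_of_door_three_four (hgo : GoodOrd W 2) (ht : ∀ x : ℚ, ¬ Greenberg1999.HasRationalTwoTorsionX W x) (hκ : κ₂.IsCyclotomic)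
    (hγ : κ₂.IsTopGenerator γ) (D : W.SelmerDualData κ₂ γ) [hSel : Finite (W.selmerGroupPInfty 2)] (hpos : ∀ n, 0 < Nat.card ↥(W.selmerLayer κ₂ n) * Nat.card (W.KerG κ₂ n)) :
    (Nat.card ↥(W.selmerLayer κ₂ 3) * Nat.card (W.KerG κ₂ 3) < 2 ^ (2 ^ 3) →
        padicValNat 2 W.tamagawaProduct + 2 * padicValNat 2 (W.reductionPointCount 2) + padicValNat 2 (Nat.card (W.selmerGroupPInfty 2)) ≤ 4) ∧
      (Nat.card ↥(W.selmerLayer κ₂ 4) * Nat.card (W.KerG κ₂ 4) < 2 ^ (2 ^ 4) →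
        padicValNat 2 W.tamagawaProduct + 2 * padicValNat 2 (W.reductionPointCount 2) + padicValNat 2 (Nat.card (W.selmerGroupPInfty 2)) ≤ 11) := by
  obtain ⟨-, -, h3⟩ := two_pow_add_dvd_natCard_selmerLayer_mul_kerG_seed W κ₂ hgo ht hκ hγ D hpos 3
  obtain ⟨-, -, h4⟩ := two_pow_add_dvd_natCard_selmerLayer_mul_kerG_seed W κ₂ hgo ht hκ hγ D hpos 4
  exact ⟨fun hlt ↦ by have := h3 hlt; norm_num at this; omega, fun hlt ↦ by have := h4 hlt; norm_num at this; omega⟩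

end Two

end Summit.BirchSwinnertonDyer.BirchSwinnertonDyer.Theorems.AlignedTransportAtTwoHalfDescentBaseIndexDoorLayers

end
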